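import Summits.HodgeConjecture.CorCM.D2Bridge.ClosedPrintedMuKeyIdentLemD3DelRecConjOmegaT
import Literature.NumberTheory.Automorphic.Liu2021.Thm418TransportMainGalois
import HarnessLib

/-!
# [Liu 2021, Thm 4.18] MAIN ISOMORPHISM + item (3) transport to the CONJUGATE SPACE's transported datum (G3 of stub G `stub_mainGaloisGlue` of
# `Lines/a3-liu418.lean` v3 1b96ade3f8b6b529)

Cell `hodgecm-mathlib` (D-0151), fan A, rung A-III; Summits lane `CorCM/HypLiu418/`; namespace `Summit.HodgeConjecture.CorCM.Lines.A3Liu418`.  Seat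
prover-hodgecm-mathlib-A-p19 (KEY `a3-main-galois-glue`), 2026-08-28.  TWO THEOREMS, the MAIN + (3) SLICE (`MainGalois`: the printed isomorphism
`Ω(μ) ⊗_{M_μ} ℂ ≃ ⊕_{(ε,χ)} ω(μ,ε,χ)` of `ℂ[𝔾(𝔸_F^∞)]`-modules TOGETHER WITH item (3), which shares it) of ✔ `MuConjIdent.thm418AsPrinted_muConj_rest_transport` and
✔ `MuConjIdent.thm418AsPrinted_muConj_rest_transport_hermConj` (`D2Bridge/MuConjIdentificationOmega.lean`), with the same binder lists and the same transport data,
run through ✔ `Thm418Data.mainGalois_transport` (`Liu2021/Thm418TransportMainGalois.lean`, p598586) instead of ✔ `thm418AsPrinted_transport` — exactly as A-p08's ✔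
`A3Liu418NonIso.lean` §2 ∕ §4 did for item (2):
* §2 `mainGalois_muConj_rest_transport` (generic `UniformOmega`): MAIN + (3) at the relabelled rest `(muConj U).rest t` passes to the datum transported along
  `φ : G′ ≃ₜ* 𝔾(𝔸_F^∞)`, index bijections `eε`, `eχ` (collections respected: `U.epsOf (−x) = eε (epsOf′ x)` on admissible `x`, [Def 4.12]) and summand isomorphisms.
* §3 `mainGalois_transport_hermConj` (face of record): at `(toThm418Data ℭ_V ((muConj 𝕌_V).rest t)).transport 𝔾_{V^c} (adelicFinConj V)⁻¹ Eps (epsOf (2δ_F)⁻¹) Chi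
  (𝕌_{V^c}.omega ν hν) (𝕌_{V^c}.rho ν hν)` from the same at `V`'s own relabelled rest, with Part VI ✔ `exists_uniformOmegaRep_conj_hermConj` at
  `(ε, ε′, χ, χ′) := (locF(−1)·ε′, ε′, χ′⁻¹, χ′)`, `eε := epsNegEquiv`, `eχ := chiInv`, `hneg := epsOf_neg_of_complexConj_eq_neg` (VERBATIM the data of the `hermConj` transport
  of the END).
ORIENTATION: none used (transport of structure).  HC_CM is proved only modulo the 7 printed citations (`hDel`, `h21`, `hLiu418`, `h411`, `h413`, `hD3`, `hD1''`)
until rung 0 closes; nothing of [Liu2021] is asserted (MAIN + (3) at the source is the HYPOTHESIS `hrow`).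

References: [Liu2021] Y. Liu, *Fourier–Jacobi cycles and arithmetic relative trace formula*, Camb. J. Math. 9 (2021) = arXiv:2102.11518, Thm. 4.18 main statement
(FJcycle.tex l. 2233–2237) and item (3) (l. 2243), Def. 4.11 (l. 2092–2096), Def. 4.12 (l. 2102–2111), Rem. 4.4, App. D Lem. D.1 (2).
-/

set_option autoImplicit false

noncomputable section

namespace Summit.HodgeConjecture.CorCM.Lines.A3Liu418

open scoped TensorProduct Matrix
open NumberField NumberField.InfinitePlace
open HodgeCM.Model HodgeCM.Model.LiuIndex HodgeCM.Model.TowerCarrier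
open Summit.HodgeConjecture.CorCM.Model
open Literature.AlgebraicGeometry.Motives (CMType)
open Literature.AlgebraicGeometry.HodgeTheory Literature.NumberTheory.Automorphic.PicardCM
open Literature.AlgebraicGeometry.ShimuraVarieties.UnitaryCanonicalModel
open Literature.NumberTheory.ComplexMultiplication
open Literature.NumberTheory.Automorphic
open Literature.NumberTheory.Automorphic.IdeleClassGroup (toHeckeCharacter isUnitary_toHeckeCharacter galConj)
open Literature.NumberTheory.Automorphic.Liu2021 Literature.NumberTheory.Automorphic.Liu2021.AppendixC
open Literature.NumberTheory.Automorphic.Liu2021.AppendixC.RestOne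
open Literature.NumberTheory.Automorphic.Liu2021.Def411WeilCarriers (lineOf locF Rep Eps epsOf Chi)
open Summit.HodgeConjecture.CorCM.Transposition.OmegaTransport (realUnit)
open HodgeCM.Model.ArchSideTerm (e₁)
open Literature.NumberTheory.GelbartRogawski1991 Literature.NumberTheory.GelbartRogawski1991.UnitaryDualPair
open Literature.NumberTheory.GelbartRogawski1991.UnitaryDualPair.LocalSplitting (localMu norm_localMu continuous_localMu localMu_toLocalRing_eq_one_iff
  eq_of_forall_localMu_toHeckeCharacter_eq)
open Literature.RepresentationTheory Literature.RepresentationTheory.Liu2021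
open Literature.AlgebraicGeometry.Liu2021 (IsAdmissibleElement)
open Summit.HodgeConjecture.CorCM.Transposition
open Summit.HodgeConjecture.CorCM.HComp.OmegaConj
open Summit.HodgeConjecture.CorCM.D2Bridge.AdapterMuConj (muConj admIndexMuConjEquiv)
open Summit.HodgeConjecture.CorCM.D2Bridge.MuConjIdent (repConj epsNegEquiv epsOf_neg_of_complexConj_eq_neg)
open Summit.HodgeConjecture.CorCM.D2Bridge.MuKeyIdentLemD3DelRecConjOmegaEnd (diagonal_frameD_map_complexConj)


open scoped DirectSum

/-! ## §2 (G3, generic) The main isomorphism + item (3) along `μ ↦ μᶜ` and a re-presentation of the relabelled rest -/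

section MuConj

variable {F₀ E₀ : Type} {iF₁ : Field F₀} {iF₂ : NumberField F₀} {iF₃ : IsTotallyReal F₀} {iE₁ : Field E₀} {iE₂ : NumberField E₀}
  {iA : Algebra F₀ E₀} {iE₃ : IsTotallyComplex E₀} {iQ : Algebra.IsQuadraticExtension F₀ E₀}
variable {P5 : PropC5Data F₀ E₀} {isotropicAt : ℕ → Prop} {C : Sec42Data P5 isotropicAt}

/-- **MAIN + (3) for the relabelled rest `(muConj U).rest t` transports along any re-presentation** of the group (`φ : G′ ≃ₜ* 𝔾(𝔸_F^∞)`), of the index types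
(`eε : Eps′ ≃ U.Eps`, `eχ : Chi′ ≃ U.Chi`, collections map `epsOf′` with `U.epsOf (−x) = eε (epsOf′ x)` on admissible `x`) and of the summands
(`Ω ε′ χ′ : U.omega νᶜ (eε ε′) (eχ χ′) ≃ₗ[ℂ] ω′ ε′ χ′` intertwining `U.rho … (φ g′)` with `ρ′ … g′`) — the main+(3) slice of ✔
`MuConjIdent.thm418AsPrinted_muConj_rest_transport` (same binder list), by ✔ `Thm418Data.mainGalois_transport` with the index bijection
`(ε′, χ′) ↦ (eε ε′, eχ χ′)` (which respects the collections, so item (3)'s `ε`-blocks correspond).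
[cite: Liu2021, Thm. 4.18 main statement (l. 2233–2237) and (3) (l. 2243); Def. 4.12 (l. 2102–2111); Rem. 4.4] -/
theorem mainGalois_muConj_rest_transport (U : UniformOmega C)
    {ν : Literature.NumberTheory.Automorphic.IdeleClassGroup E₀ →ₜ* Circle}
    {hν : letI : IsCMField E₀ := isCMField F₀ E₀; IdeleClassGroup.IsConjugateSymplectic E₀ ν} (t : RestTail C ν hν)
    (G' : Type) [Group G'] [TopologicalSpace G'] [IsTopologicalGroup G'] (φ : G' ≃ₜ* C.G)
    (Eps' : Type) (epsOf' : E₀ → Eps') (Chi' : Type) (omega' : Eps' → Chi' → Type)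
    [∀ ε χ, AddCommGroup (omega' ε χ)] [∀ ε χ, Module ℂ (omega' ε χ)]
    (rho' : ∀ ε χ, Representation ℂ G' (omega' ε χ))
    (eε : Eps' ≃ U.Eps) (eχ : Chi' ≃ U.Chi)
    (hneg : ∀ x : E₀, (letI : IsCMField E₀ := isCMField F₀ E₀;
        IsAdmissibleElement E₀ (AppendixC.toThm418Data C ((muConj U).rest t)).cmType.1 x) →
        U.epsOf (-x) = eε (epsOf' x))
    (Ω : ∀ ε χ, U.omega _ (letI : IsCMField E₀ := isCMField F₀ E₀; hν.galConj) (eε ε) (eχ χ) ≃ₗ[ℂ] omega' ε χ)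
    (hΩ : ∀ ε χ (g' : G') (x : U.omega _ (letI : IsCMField E₀ := isCMField F₀ E₀; hν.galConj) (eε ε) (eχ χ)),
      Ω ε χ (U.rho _ _ (eε ε) (eχ χ) (φ g') x) = rho' ε χ g' (Ω ε χ x))
    (hrow : ∃ Θ : (ℂ ⊗[fieldOfValues (E₀) (AppendixC.toThm418Data C ((muConj U).rest t)).μ] (AppendixC.toThm418Data C ((muConj U).rest t)).Ω) ≃ₗ[ℂ] (⨁ i : (AppendixC.toThm418Data C ((muConj U).rest t)).AdmIndex, (AppendixC.toThm418Data C ((muConj U).rest t)).omegaAt i),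
        (∀ (g : (AppendixC.toThm418Data C ((muConj U).rest t)).G) (x : ℂ ⊗[fieldOfValues (E₀) (AppendixC.toThm418Data C ((muConj U).rest t)).μ] (AppendixC.toThm418Data C ((muConj U).rest t)).Ω) (i : (AppendixC.toThm418Data C ((muConj U).rest t)).AdmIndex),
            Θ (((AppendixC.toThm418Data C ((muConj U).rest t)).rhoΩ g).baseChange ℂ x) i = (AppendixC.toThm418Data C ((muConj U).rest t)).rhoAt i g (Θ x i)) ∧
        (∀ ε : (AppendixC.toThm418Data C ((muConj U).rest t)).Eps, (AppendixC.toThm418Data C ((muConj U).rest t)).IsAdmissible ε → ∀ (σ : ℂ ≃ₐ[fieldOfValues (E₀) (AppendixC.toThm418Data C ((muConj U).rest t)).μ] ℂ) (x : ℂ ⊗[fieldOfValues (E₀) (AppendixC.toThm418Data C ((muConj U).rest t)).μ] (AppendixC.toThm418Data C ((muConj U).rest t)).Ω),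
            (∀ i : (AppendixC.toThm418Data C ((muConj U).rest t)).AdmIndex, i.1.1 ≠ ε → Θ x i = 0) → ∀ i : (AppendixC.toThm418Data C ((muConj U).rest t)).AdmIndex, i.1.1 ≠ ε → Θ ((AppendixC.toThm418Data C ((muConj U).rest t)).galoisAct σ x) i = 0)) :
    ∃ Θ : (ℂ ⊗[fieldOfValues (E₀) ((AppendixC.toThm418Data C ((muConj U).rest t)).transport G' φ Eps' epsOf' Chi' omega' rho').μ] ((AppendixC.toThm418Data C ((muConj U).rest t)).transport G' φ Eps' epsOf' Chi' omega' rho').Ω) ≃ₗ[ℂ] (⨁ i : ((AppendixC.toThm418Data C ((muConj U).rest t)).transport G' φ Eps' epsOf' Chi' omega' rho').AdmIndex, ((AppendixC.toThm418Data C ((muConj U).rest t)).transport G' φ Eps' epsOf' Chi' omega' rho').omegaAt i),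
        (∀ (g : ((AppendixC.toThm418Data C ((muConj U).rest t)).transport G' φ Eps' epsOf' Chi' omega' rho').G) (x : ℂ ⊗[fieldOfValues (E₀) ((AppendixC.toThm418Data C ((muConj U).rest t)).transport G' φ Eps' epsOf' Chi' omega' rho').μ] ((AppendixC.toThm418Data C ((muConj U).rest t)).transport G' φ Eps' epsOf' Chi' omega' rho').Ω) (i : ((AppendixC.toThm418Data C ((muConj U).rest t)).transport G' φ Eps' epsOf' Chi' omega' rho').AdmIndex),
            Θ ((((AppendixC.toThm418Data C ((muConj U).rest t)).transport G' φ Eps' epsOf' Chi' omega' rho').rhoΩ g).baseChange ℂ x) i = ((AppendixC.toThm418Data C ((muConj U).rest t)).transport G' φ Eps' epsOf' Chi' omega' rho').rhoAt i g (Θ x i)) ∧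
        (∀ ε : ((AppendixC.toThm418Data C ((muConj U).rest t)).transport G' φ Eps' epsOf' Chi' omega' rho').Eps, ((AppendixC.toThm418Data C ((muConj U).rest t)).transport G' φ Eps' epsOf' Chi' omega' rho').IsAdmissible ε → ∀ (σ : ℂ ≃ₐ[fieldOfValues (E₀) ((AppendixC.toThm418Data C ((muConj U).rest t)).transport G' φ Eps' epsOf' Chi' omega' rho').μ] ℂ) (x : ℂ ⊗[fieldOfValues (E₀) ((AppendixC.toThm418Data C ((muConj U).rest t)).transport G' φ Eps' epsOf' Chi' omega' rho').μ] ((AppendixC.toThm418Data C ((muConj U).rest t)).transport G' φ Eps' epsOf' Chi' omega' rho').Ω),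
            (∀ i : ((AppendixC.toThm418Data C ((muConj U).rest t)).transport G' φ Eps' epsOf' Chi' omega' rho').AdmIndex, i.1.1 ≠ ε → Θ x i = 0) → ∀ i : ((AppendixC.toThm418Data C ((muConj U).rest t)).transport G' φ Eps' epsOf' Chi' omega' rho').AdmIndex, i.1.1 ≠ ε → Θ (((AppendixC.toThm418Data C ((muConj U).rest t)).transport G' φ Eps' epsOf' Chi' omega' rho').galoisAct σ x) i = 0) := by
  letI : IsCMField E₀ := isCMField F₀ E₀
  -- [Def. 4.12] on collections: admissibility at the two collection maps corresponds under `eε`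
  have hadm_iff : ∀ ε' : Eps',
      ((AppendixC.toThm418Data C ((muConj U).rest t)).transport G' φ Eps' epsOf' Chi' omega' rho').IsAdmissible ε' ↔
        (AppendixC.toThm418Data C ((muConj U).rest t)).IsAdmissible (eε ε') := by
    intro ε'
    constructor
    · rintro ⟨x, hx, hxε⟩
      refine ⟨x, hx, ?_⟩
      change U.epsOf (-x) = eε ε'
      rw [hneg x hx]
      exact congrArg eε hxε
    · rintro ⟨x, hx, hxε⟩
      refine ⟨x, hx, eε.injective ?_⟩
      change eε (epsOf' x) = eε ε'
      change U.epsOf (-x) = eε ε' at hxε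
      rw [← hneg x hx]
      exact hxε
  -- the index bijection `(ε′, χ′) ↦ (eε ε′, eχ χ′)`
  let e : ((AppendixC.toThm418Data C ((muConj U).rest t)).transport G' φ Eps' epsOf' Chi' omega' rho').AdmIndex ≃
      (AppendixC.toThm418Data C ((muConj U).rest t)).AdmIndex :=
    { toFun := fun i' => ⟨(eε i'.1.1, eχ i'.1.2), (hadm_iff _).1 i'.2⟩
      invFun := fun i => ⟨(eε.symm i.1.1, eχ.symm i.1.2), (hadm_iff _).2 (by rw [Equiv.apply_symm_apply]; exact i.2)⟩
      left_inv := fun i' => Subtype.ext (Prod.ext (eε.symm_apply_apply _) (eχ.symm_apply_apply _))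
      right_inv := fun i => Subtype.ext (Prod.ext (eε.apply_symm_apply _) (eχ.apply_symm_apply _)) }
  refine Thm418Data.mainGalois_transport (AppendixC.toThm418Data C ((muConj U).rest t)) G' φ Eps' epsOf' Chi' omega' rho' e
    (fun ε' => eε ε') eε.injective (fun _ => rfl) (fun ε' h => (hadm_iff ε').1 h) (fun i' => (Ω i'.1.1 i'.1.2).symm) ?_ hrow
  intro i' g' y
  change (Ω i'.1.1 i'.1.2).symm (rho' i'.1.1 i'.1.2 g' y) =
    U.rho _ hν.galConj (eε i'.1.1) (eχ i'.1.2) (φ g') ((Ω i'.1.1 i'.1.2).symm y)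
  rw [LinearEquiv.symm_apply_eq, hΩ, LinearEquiv.apply_symm_apply]

end MuConj

/-! ## §3 (G3, face of record) The main isomorphism + (3) at the CONJUGATE SPACE's transported datum from `V`'s own relabelled rest -/

section HermConj

set_option maxHeartbeats 1600000 in
/-- **[Liu2021, Thm 4.18] MAIN + (3) AT THE CONJUGATE SPACE's TRANSPORTED DATUM from the same at `V`'s own relabelled rest.**  Datum:
`(toThm418Data ℭ_V ((muConj 𝕌_V).rest t)).transport 𝔾_{V^c} (adelicFinConj V)⁻¹ Eps (epsOf (2δ_F)⁻¹) Chi (𝕌_{V^c}.omega ν hν) (𝕌_{V^c}.rho ν hν)` — the conjugate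
space's own [Def 4.11] family `𝕌_{V^c} = uniformOmegaRep … V.conj Φ′ … (iotaVConj …) (2δ_F)⁻¹ (repConj F r)` at `ν`, `U(V^c)(𝔸_{F⁺,f})` acting natively, for ANY tail
`t` at `ν`.  Route: §2 with the transport data of ✔ `MuConjIdent.thm418AsPrinted_muConj_rest_transport_hermConj` VERBATIM — Part VI ✔
`exists_uniformOmegaRep_conj_hermConj` at `(ε, ε′, χ, χ′) := (locF(−1)·ε′, ε′, χ′⁻¹, χ′)`, `eε := epsNegEquiv`, `eχ := chiInv`, `hneg := epsOf_neg_of_complexConj_eq_neg`.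
Orientation-free.  Nothing of [Liu2021] is asserted.
[cite: Liu2021, Thm. 4.18 main statement (l. 2233–2237) and (3) (l. 2243), Def. 4.11 (l. 2092–2096), Def. 4.12 (l. 2102–2111), Rem. 4.4, App. D Lem. D.1 (2) (l. 5231)] -/
theorem mainGalois_transport_hermConj (h : exists_recordSystem) (F : CMField) [IsGalois ℚ F]
    (ι₁ : F →+* ℂ) (V : HermSpace3 F ι₁) (Φ Φ' : CMType F) {n : ℕ} (e : Fin 3 × Fin 1 ≃ Fin n) (dV : Fin 3 → F)
    (hdV : ∀ i, IsCMField.complexConj F (dV i) = dV i) (hdV0 : ∀ i, dV i ≠ 0)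
    (hJc : (Matrix.diagonal dV).map ((IsCMField.complexConj F : F ≃ₐ[↥(maximalRealSubfield F)] F) : F →+* F) = Matrix.diagonal dV)
    (ιV : (sec42DataOf h isoOf F ι₁ V Φ).G →* UnitaryGroup.finAdelic ↥(maximalRealSubfield F) F (IsCMField.complexConj F) 3 (Matrix.diagonal dV))
    (r : Rep ↥(maximalRealSubfield F) (imagUnitSq F))
    (ν : Literature.NumberTheory.Automorphic.IdeleClassGroup F →ₜ* Circle) (hν : IdeleClassGroup.IsConjugateSymplectic F ν)
    (tc : RestTail (sec42DataOf h isoOf F ι₁ V Φ) ν hν)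
    (hrow : ∃ Θ : (ℂ ⊗[fieldOfValues (F) (AppendixC.toThm418Data (sec42DataOf h isoOf F ι₁ V Φ) ((muConj (uniformOmegaRep h F ι₁ V Φ e dV hdV hdV0 ιV (2 * imagUnit F)⁻¹ (fun _ _ => r))).rest tc)).μ] (AppendixC.toThm418Data (sec42DataOf h isoOf F ι₁ V Φ) ((muConj (uniformOmegaRep h F ι₁ V Φ e dV hdV hdV0 ιV (2 * imagUnit F)⁻¹ (fun _ _ => r))).rest tc)).Ω) ≃ₗ[ℂ] (⨁ i : (AppendixC.toThm418Data (sec42DataOf h isoOf F ι₁ V Φ) ((muConj (uniformOmegaRep h F ι₁ V Φ e dV hdV hdV0 ιV (2 * imagUnit F)⁻¹ (fun _ _ => r))).rest tc)).AdmIndex, (AppendixC.toThm418Data (sec42DataOf h isoOf F ι₁ V Φ) ((muConj (uniformOmegaRep h F ι₁ V Φ e dV hdV hdV0 ιV (2 * imagUnit F)⁻¹ (fun _ _ => r))).rest tc)).omegaAt i),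
        (∀ (g : (AppendixC.toThm418Data (sec42DataOf h isoOf F ι₁ V Φ) ((muConj (uniformOmegaRep h F ι₁ V Φ e dV hdV hdV0 ιV (2 * imagUnit F)⁻¹ (fun _ _ => r))).rest tc)).G) (x : ℂ ⊗[fieldOfValues (F) (AppendixC.toThm418Data (sec42DataOf h isoOf F ι₁ V Φ) ((muConj (uniformOmegaRep h F ι₁ V Φ e dV hdV hdV0 ιV (2 * imagUnit F)⁻¹ (fun _ _ => r))).rest tc)).μ] (AppendixC.toThm418Data (sec42DataOf h isoOf F ι₁ V Φ) ((muConj (uniformOmegaRep h F ι₁ V Φ e dV hdV hdV0 ιV (2 * imagUnit F)⁻¹ (fun _ _ => r))).rest tc)).Ω) (i : (AppendixC.toThm418Data (sec42DataOf h isoOf F ι₁ V Φ) ((muConj (uniformOmegaRep h F ι₁ V Φ e dV hdV hdV0 ιV (2 * imagUnit F)⁻¹ (fun _ _ => r))).rest tc)).AdmIndex),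
            Θ (((AppendixC.toThm418Data (sec42DataOf h isoOf F ι₁ V Φ) ((muConj (uniformOmegaRep h F ι₁ V Φ e dV hdV hdV0 ιV (2 * imagUnit F)⁻¹ (fun _ _ => r))).rest tc)).rhoΩ g).baseChange ℂ x) i = (AppendixC.toThm418Data (sec42DataOf h isoOf F ι₁ V Φ) ((muConj (uniformOmegaRep h F ι₁ V Φ e dV hdV hdV0 ιV (2 * imagUnit F)⁻¹ (fun _ _ => r))).rest tc)).rhoAt i g (Θ x i)) ∧
        (∀ ε : (AppendixC.toThm418Data (sec42DataOf h isoOf F ι₁ V Φ) ((muConj (uniformOmegaRep h F ι₁ V Φ e dV hdV hdV0 ιV (2 * imagUnit F)⁻¹ (fun _ _ => r))).rest tc)).Eps, (AppendixC.toThm418Data (sec42DataOf h isoOf F ι₁ V Φ) ((muConj (uniformOmegaRep h F ι₁ V Φ e dV hdV hdV0 ιV (2 * imagUnit F)⁻¹ (fun _ _ => r))).rest tc)).IsAdmissible ε → ∀ (σ : ℂ ≃ₐ[fieldOfValues (F) (AppendixC.toThm418Data (sec42DataOf h isoOf F ι₁ V Φ) ((muConj (uniformOmegaRep h F ι₁ V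 Φ e dV hdV hdV0 ιV (2 * imagUnit F)⁻¹ (fun _ _ => r))).rest tc)).μ] ℂ) (x : ℂ ⊗[fieldOfValues (F) (AppendixC.toThm418Data (sec42DataOf h isoOf F ι₁ V Φ) ((muConj (uniformOmegaRep h F ι₁ V Φ e dV hdV hdV0 ιV (2 * imagUnit F)⁻¹ (fun _ _ => r))).rest tc)).μ] (AppendixC.toThm418Data (sec42DataOf h isoOf F ι₁ V Φ) ((muConj (uniformOmegaRep h F ι₁ V Φ e dV hdV hdV0 ιV (2 * imagUnit F)⁻¹ (fun _ _ => r))).rest tc)).Ω),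
            (∀ i : (AppendixC.toThm418Data (sec42DataOf h isoOf F ι₁ V Φ) ((muConj (uniformOmegaRep h F ι₁ V Φ e dV hdV hdV0 ιV (2 * imagUnit F)⁻¹ (fun _ _ => r))).rest tc)).AdmIndex, i.1.1 ≠ ε → Θ x i = 0) → ∀ i : (AppendixC.toThm418Data (sec42DataOf h isoOf F ι₁ V Φ) ((muConj (uniformOmegaRep h F ι₁ V Φ e dV hdV hdV0 ιV (2 * imagUnit F)⁻¹ (fun _ _ => r))).rest tc)).AdmIndex, i.1.1 ≠ ε → Θ ((AppendixC.toThm418Data (sec42DataOf h isoOf F ι₁ V Φ) ((muConj (uniformOmegaRep h F ι₁ V Φ e dV hdV hdV0 ιV (2 * imagUnit F)⁻¹ (fun _ _ => r))).rest tc)).galoisAct σ x) i = 0)) :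
    ∃ Θ : (ℂ ⊗[fieldOfValues (F) ((AppendixC.toThm418Data (sec42DataOf h isoOf F ι₁ V Φ) ((muConj (uniformOmegaRep h F ι₁ V Φ e dV hdV hdV0 ιV (2 * imagUnit F)⁻¹ (fun _ _ => r))).rest tc)).transport (sec42DataOf h isoOf F ι₁ V.conj Φ').G (HermSpace3.adelicFinConj V).symm (Eps ↥(maximalRealSubfield F) (imagUnitSq F)) (epsOf ↥(maximalRealSubfield F) (imagUnitSq F) F (2 * imagUnit F)⁻¹) (Chi ↥(maximalRealSubfield F) F (IsCMField.complexConj F)) ((uniformOmegaRep h F ι₁ V.conj Φ' e dV hdV hdV0 (iotaVConj h F ι₁ V Φ Φ' dV ιV hJc) (2 * imagUnit F)⁻¹ (repConj F (fun _ _ => r))).omega ν hν) ((uniformOmegaRep h F ι₁ V.conj Φ' e dV hdV hdV0 (iotaVConj h F ι₁ V Φ Φ' dV ιV hJc) (2 * imagUnit F)⁻¹ (repConj F (fun _ _ => r))).rho ν hν)).μ] ((AppendixC.toThm418Data (sec42DataOf h isoOf F ι₁ V Φ) ((muConj (uniformOmegaRep h F ι₁ V Φ e dV hdV hdV0 ιV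 (2 * imagUnit F)⁻¹ (fun _ _ => r))).rest tc)).transport (sec42DataOf h isoOf F ι₁ V.conj Φ').G (HermSpace3.adelicFinConj V).symm (Eps ↥(maximalRealSubfield F) (imagUnitSq F)) (epsOf ↥(maximalRealSubfield F) (imagUnitSq F) F (2 * imagUnit F)⁻¹) (Chi ↥(maximalRealSubfield F) F (IsCMField.complexConj F)) ((uniformOmegaRep h F ι₁ V.conj Φ' e dV hdV hdV0 (iotaVConj h F ι₁ V Φ Φ' dV ιV hJc) (2 * imagUnit F)⁻¹ (repConj F (fun _ _ => r))).omega ν hν) ((uniformOmegaRep h F ι₁ V.conj Φ' e dV hdV hdV0 (iotaVConj h F ι₁ V Φ Φ' dV ιV hJc) (2 * imagUnit F)⁻¹ (repConj F (fun _ _ => r))).rho ν hν)).Ω) ≃ₗ[ℂ] (⨁ i : ((AppendixC.toThm418Data (sec42DataOf h isoOf F ι₁ V Φ) ((muConj (uniformOmegaRep h F ι₁ V Φ e dV hdV hdV0 ιV (2 * imagUnit F)⁻¹ (fun _ _ => r))).rest tc)).transport (sec42DataOf h isoOf F ι₁ V.conj Φ').G (HermSpace3.adelicFinConj V).symm (Eps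 ↥(maximalRealSubfield F) (imagUnitSq F)) (epsOf ↥(maximalRealSubfield F) (imagUnitSq F) F (2 * imagUnit F)⁻¹) (Chi ↥(maximalRealSubfield F) F (IsCMField.complexConj F)) ((uniformOmegaRep h F ι₁ V.conj Φ' e dV hdV hdV0 (iotaVConj h F ι₁ V Φ Φ' dV ιV hJc) (2 * imagUnit F)⁻¹ (repConj F (fun _ _ => r))).omega ν hν) ((uniformOmegaRep h F ι₁ V.conj Φ' e dV hdV hdV0 (iotaVConj h F ι₁ V Φ Φ' dV ιV hJc) (2 * imagUnit F)⁻¹ (repConj F (fun _ _ => r))).rho ν hν)).AdmIndex, ((AppendixC.toThm418Data (sec42DataOf h isoOf F ι₁ V Φ) ((muConj (uniformOmegaRep h F ι₁ V Φ e dV hdV hdV0 ιV (2 * imagUnit F)⁻¹ (fun _ _ => r))).rest tc)).transport (sec42DataOf h isoOf F ι₁ V.conj Φ').G (HermSpace3.adelicFinConj V).symm (Eps ↥(maximalRealSubfield F) (imagUnitSq F)) (epsOf ↥(maximalRealSubfield F) (imagUnitSq F) F (2 * imagUnit F)⁻¹) (Chi ↥(maximalRealSubfield F) F (IsCMField.complexConj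 F)) ((uniformOmegaRep h F ι₁ V.conj Φ' e dV hdV hdV0 (iotaVConj h F ι₁ V Φ Φ' dV ιV hJc) (2 * imagUnit F)⁻¹ (repConj F (fun _ _ => r))).omega ν hν) ((uniformOmegaRep h F ι₁ V.conj Φ' e dV hdV hdV0 (iotaVConj h F ι₁ V Φ Φ' dV ιV hJc) (2 * imagUnit F)⁻¹ (repConj F (fun _ _ => r))).rho ν hν)).omegaAt i),
        (∀ (g : ((AppendixC.toThm418Data (sec42DataOf h isoOf F ι₁ V Φ) ((muConj (uniformOmegaRep h F ι₁ V Φ e dV hdV hdV0 ιV (2 * imagUnit F)⁻¹ (fun _ _ => r))).rest tc)).transport (sec42DataOf h isoOf F ι₁ V.conj Φ').G (HermSpace3.adelicFinConj V).symm (Eps ↥(maximalRealSubfield F) (imagUnitSq F)) (epsOf ↥(maximalRealSubfield F) (imagUnitSq F) F (2 * imagUnit F)⁻¹) (Chi ↥(maximalRealSubfield F) F (IsCMField.complexConj F)) ((uniformOmegaRep h F ι₁ V.conj Φ' e dV hdV hdV0 (iotaVConj h F ι₁ V Φ Φ' dV ιV hJc) (2 * imagUnit F)⁻¹ (repConj F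 (fun _ _ => r))).omega ν hν) ((uniformOmegaRep h F ι₁ V.conj Φ' e dV hdV hdV0 (iotaVConj h F ι₁ V Φ Φ' dV ιV hJc) (2 * imagUnit F)⁻¹ (repConj F (fun _ _ => r))).rho ν hν)).G) (x : ℂ ⊗[fieldOfValues (F) ((AppendixC.toThm418Data (sec42DataOf h isoOf F ι₁ V Φ) ((muConj (uniformOmegaRep h F ι₁ V Φ e dV hdV hdV0 ιV (2 * imagUnit F)⁻¹ (fun _ _ => r))).rest tc)).transport (sec42DataOf h isoOf F ι₁ V.conj Φ').G (HermSpace3.adelicFinConj V).symm (Eps ↥(maximalRealSubfield F) (imagUnitSq F)) (epsOf ↥(maximalRealSubfield F) (imagUnitSq F) F (2 * imagUnit F)⁻¹) (Chi ↥(maximalRealSubfield F) F (IsCMField.complexConj F)) ((uniformOmegaRep h F ι₁ V.conj Φ' e dV hdV hdV0 (iotaVConj h F ι₁ V Φ Φ' dV ιV hJc) (2 * imagUnit F)⁻¹ (repConj F (fun _ _ => r))).omega ν hν) ((uniformOmegaRep h F ι₁ V.conj Φ' e dV hdV hdV0 (iotaVConj h F ι₁ V Φ Φ' dV ιV hJc)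 (2 * imagUnit F)⁻¹ (repConj F (fun _ _ => r))).rho ν hν)).μ] ((AppendixC.toThm418Data (sec42DataOf h isoOf F ι₁ V Φ) ((muConj (uniformOmegaRep h F ι₁ V Φ e dV hdV hdV0 ιV (2 * imagUnit F)⁻¹ (fun _ _ => r))).rest tc)).transport (sec42DataOf h isoOf F ι₁ V.conj Φ').G (HermSpace3.adelicFinConj V).symm (Eps ↥(maximalRealSubfield F) (imagUnitSq F)) (epsOf ↥(maximalRealSubfield F) (imagUnitSq F) F (2 * imagUnit F)⁻¹) (Chi ↥(maximalRealSubfield F) F (IsCMField.complexConj F)) ((uniformOmegaRep h F ι₁ V.conj Φ' e dV hdV hdV0 (iotaVConj h F ι₁ V Φ Φ' dV ιV hJc) (2 * imagUnit F)⁻¹ (repConj F (fun _ _ => r))).omega ν hν) ((uniformOmegaRep h F ι₁ V.conj Φ' e dV hdV hdV0 (iotaVConj h F ι₁ V Φ Φ' dV ιV hJc) (2 * imagUnit F)⁻¹ (repConj F (fun _ _ => r))).rho ν hν)).Ω) (i : ((AppendixC.toThm418Data (sec42DataOf h isoOf F ι₁ V Φ) ((muConj (uniformOmegaRep h F ι₁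 V Φ e dV hdV hdV0 ιV (2 * imagUnit F)⁻¹ (fun _ _ => r))).rest tc)).transport (sec42DataOf h isoOf F ι₁ V.conj Φ').G (HermSpace3.adelicFinConj V).symm (Eps ↥(maximalRealSubfield F) (imagUnitSq F)) (epsOf ↥(maximalRealSubfield F) (imagUnitSq F) F (2 * imagUnit F)⁻¹) (Chi ↥(maximalRealSubfield F) F (IsCMField.complexConj F)) ((uniformOmegaRep h F ι₁ V.conj Φ' e dV hdV hdV0 (iotaVConj h F ι₁ V Φ Φ' dV ιV hJc) (2 * imagUnit F)⁻¹ (repConj F (fun _ _ => r))).omega ν hν) ((uniformOmegaRep h F ι₁ V.conj Φ' e dV hdV hdV0 (iotaVConj h F ι₁ V Φ Φ' dV ιV hJc) (2 * imagUnit F)⁻¹ (repConj F (fun _ _ => r))).rho ν hν)).AdmIndex),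
            Θ ((((AppendixC.toThm418Data (sec42DataOf h isoOf F ι₁ V Φ) ((muConj (uniformOmegaRep h F ι₁ V Φ e dV hdV hdV0 ιV (2 * imagUnit F)⁻¹ (fun _ _ => r))).rest tc)).transport (sec42DataOf h isoOf F ι₁ V.conj Φ').G (HermSpace3.adelicFinConj V).symm (Eps ↥(maximalRealSubfield F) (imagUnitSq F)) (epsOf ↥(maximalRealSubfield F) (imagUnitSq F) F (2 * imagUnit F)⁻¹) (Chi ↥(maximalRealSubfield F) F (IsCMField.complexConj F)) ((uniformOmegaRep h F ι₁ V.conj Φ' e dV hdV hdV0 (iotaVConj h F ι₁ V Φ Φ' dV ιV hJc) (2 * imagUnit F)⁻¹ (repConj F (fun _ _ => r))).omega ν hν) ((uniformOmegaRep h F ι₁ V.conj Φ' e dV hdV hdV0 (iotaVConj h F ι₁ V Φ Φ' dV ιV hJc) (2 * imagUnit F)⁻¹ (repConj F (fun _ _ => r))).rho ν hν)).rhoΩ g).baseChange ℂ x) i = ((AppendixC.toThm418Data (sec42DataOf h isoOf F ι₁ V Φ) ((muConj (uniformOmegaRep h F ι₁ V Φ e dV hdV hdV0 ιV (2 * imagUnit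 F)⁻¹ (fun _ _ => r))).rest tc)).transport (sec42DataOf h isoOf F ι₁ V.conj Φ').G (HermSpace3.adelicFinConj V).symm (Eps ↥(maximalRealSubfield F) (imagUnitSq F)) (epsOf ↥(maximalRealSubfield F) (imagUnitSq F) F (2 * imagUnit F)⁻¹) (Chi ↥(maximalRealSubfield F) F (IsCMField.complexConj F)) ((uniformOmegaRep h F ι₁ V.conj Φ' e dV hdV hdV0 (iotaVConj h F ι₁ V Φ Φ' dV ιV hJc) (2 * imagUnit F)⁻¹ (repConj F (fun _ _ => r))).omega ν hν) ((uniformOmegaRep h F ι₁ V.conj Φ' e dV hdV hdV0 (iotaVConj h F ι₁ V Φ Φ' dV ιV hJc) (2 * imagUnit F)⁻¹ (repConj F (fun _ _ => r))).rho ν hν)).rhoAt i g (Θ x i)) ∧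
        (∀ ε : ((AppendixC.toThm418Data (sec42DataOf h isoOf F ι₁ V Φ) ((muConj (uniformOmegaRep h F ι₁ V Φ e dV hdV hdV0 ιV (2 * imagUnit F)⁻¹ (fun _ _ => r))).rest tc)).transport (sec42DataOf h isoOf F ι₁ V.conj Φ').G (HermSpace3.adelicFinConj V).symm (Eps ↥(maximalRealSubfield F) (imagUnitSq F)) (epsOf ↥(maximalRealSubfield F) (imagUnitSq F) F (2 * imagUnit F)⁻¹) (Chi ↥(maximalRealSubfield F) F (IsCMField.complexConj F)) ((uniformOmegaRep h F ι₁ V.conj Φ' e dV hdV hdV0 (iotaVConj h F ι₁ V Φ Φ' dV ιV hJc) (2 * imagUnit F)⁻¹ (repConj F (fun _ _ => r))).omega ν hν) ((uniformOmegaRep h F ι₁ V.conj Φ' e dV hdV hdV0 (iotaVConj h F ι₁ V Φ Φ' dV ιV hJc) (2 * imagUnit F)⁻¹ (repConj F (fun _ _ => r))).rho ν hν)).Eps, ((AppendixC.toThm418Data (sec42DataOf h isoOf F ι₁ V Φ) ((muConj (uniformOmegaRep h F ι₁ V Φ e dV hdV hdV0 ιV (2 * imagUnit F)⁻¹ (fun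 _ _ => r))).rest tc)).transport (sec42DataOf h isoOf F ι₁ V.conj Φ').G (HermSpace3.adelicFinConj V).symm (Eps ↥(maximalRealSubfield F) (imagUnitSq F)) (epsOf ↥(maximalRealSubfield F) (imagUnitSq F) F (2 * imagUnit F)⁻¹) (Chi ↥(maximalRealSubfield F) F (IsCMField.complexConj F)) ((uniformOmegaRep h F ι₁ V.conj Φ' e dV hdV hdV0 (iotaVConj h F ι₁ V Φ Φ' dV ιV hJc) (2 * imagUnit F)⁻¹ (repConj F (fun _ _ => r))).omega ν hν) ((uniformOmegaRep h F ι₁ V.conj Φ' e dV hdV hdV0 (iotaVConj h F ι₁ V Φ Φ' dV ιV hJc) (2 * imagUnit F)⁻¹ (repConj F (fun _ _ => r))).rho ν hν)).IsAdmissible ε → ∀ (σ : ℂ ≃ₐ[fieldOfValues (F) ((AppendixC.toThm418Data (sec42DataOf h isoOf F ι₁ V Φ) ((muConj (uniformOmegaRep h F ι₁ V Φ e dV hdV hdV0 ιV (2 * imagUnit F)⁻¹ (fun _ _ => r))).rest tc)).transport (sec42DataOf h isoOf F ι₁ V.conj Φ').G (HermSpace3.adelicFinConj V).symm (Eps ↥(maximalRealSubfield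 F) (imagUnitSq F)) (epsOf ↥(maximalRealSubfield F) (imagUnitSq F) F (2 * imagUnit F)⁻¹) (Chi ↥(maximalRealSubfield F) F (IsCMField.complexConj F)) ((uniformOmegaRep h F ι₁ V.conj Φ' e dV hdV hdV0 (iotaVConj h F ι₁ V Φ Φ' dV ιV hJc) (2 * imagUnit F)⁻¹ (repConj F (fun _ _ => r))).omega ν hν) ((uniformOmegaRep h F ι₁ V.conj Φ' e dV hdV hdV0 (iotaVConj h F ι₁ V Φ Φ' dV ιV hJc) (2 * imagUnit F)⁻¹ (repConj F (fun _ _ => r))).rho ν hν)).μ] ℂ) (x : ℂ ⊗[fieldOfValues (F) ((AppendixC.toThm418Data (sec42DataOf h isoOf F ι₁ V Φ) ((muConj (uniformOmegaRep h F ι₁ V Φ e dV hdV hdV0 ιV (2 * imagUnit F)⁻¹ (fun _ _ => r))).rest tc)).transport (sec42DataOf h isoOf F ι₁ V.conj Φ').G (HermSpace3.adelicFinConj V).symm (Eps ↥(maximalRealSubfield F) (imagUnitSq F)) (epsOf ↥(maximalRealSubfield F) (imagUnitSq F) F (2 * imagUnit F)⁻¹) (Chi ↥(maximalRealSubfield F)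 F (IsCMField.complexConj F)) ((uniformOmegaRep h F ι₁ V.conj Φ' e dV hdV hdV0 (iotaVConj h F ι₁ V Φ Φ' dV ιV hJc) (2 * imagUnit F)⁻¹ (repConj F (fun _ _ => r))).omega ν hν) ((uniformOmegaRep h F ι₁ V.conj Φ' e dV hdV hdV0 (iotaVConj h F ι₁ V Φ Φ' dV ιV hJc) (2 * imagUnit F)⁻¹ (repConj F (fun _ _ => r))).rho ν hν)).μ] ((AppendixC.toThm418Data (sec42DataOf h isoOf F ι₁ V Φ) ((muConj (uniformOmegaRep h F ι₁ V Φ e dV hdV hdV0 ιV (2 * imagUnit F)⁻¹ (fun _ _ => r))).rest tc)).transport (sec42DataOf h isoOf F ι₁ V.conj Φ').G (HermSpace3.adelicFinConj V).symm (Eps ↥(maximalRealSubfield F) (imagUnitSq F)) (epsOf ↥(maximalRealSubfield F) (imagUnitSq F) F (2 * imagUnit F)⁻¹) (Chi ↥(maximalRealSubfield F) F (IsCMField.complexConj F)) ((uniformOmegaRep h F ι₁ V.conj Φ' e dV hdV hdV0 (iotaVConj h F ι₁ V Φ Φ' dV ιV hJc) (2 * imagUnit F)⁻¹ (repConj F (fun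 _ _ => r))).omega ν hν) ((uniformOmegaRep h F ι₁ V.conj Φ' e dV hdV hdV0 (iotaVConj h F ι₁ V Φ Φ' dV ιV hJc) (2 * imagUnit F)⁻¹ (repConj F (fun _ _ => r))).rho ν hν)).Ω),
            (∀ i : ((AppendixC.toThm418Data (sec42DataOf h isoOf F ι₁ V Φ) ((muConj (uniformOmegaRep h F ι₁ V Φ e dV hdV hdV0 ιV (2 * imagUnit F)⁻¹ (fun _ _ => r))).rest tc)).transport (sec42DataOf h isoOf F ι₁ V.conj Φ').G (HermSpace3.adelicFinConj V).symm (Eps ↥(maximalRealSubfield F) (imagUnitSq F)) (epsOf ↥(maximalRealSubfield F) (imagUnitSq F) F (2 * imagUnit F)⁻¹) (Chi ↥(maximalRealSubfield F) F (IsCMField.complexConj F)) ((uniformOmegaRep h F ι₁ V.conj Φ' e dV hdV hdV0 (iotaVConj h F ι₁ V Φ Φ' dV ιV hJc) (2 * imagUnit F)⁻¹ (repConj F (fun _ _ => r))).omega ν hν) ((uniformOmegaRep h F ι₁ V.conj Φ' e dV hdV hdV0 (iotaVConj h F ι₁ V Φ Φ' dV ιV hJc) (2 * imagUnit F)⁻¹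 (repConj F (fun _ _ => r))).rho ν hν)).AdmIndex, i.1.1 ≠ ε → Θ x i = 0) → ∀ i : ((AppendixC.toThm418Data (sec42DataOf h isoOf F ι₁ V Φ) ((muConj (uniformOmegaRep h F ι₁ V Φ e dV hdV hdV0 ιV (2 * imagUnit F)⁻¹ (fun _ _ => r))).rest tc)).transport (sec42DataOf h isoOf F ι₁ V.conj Φ').G (HermSpace3.adelicFinConj V).symm (Eps ↥(maximalRealSubfield F) (imagUnitSq F)) (epsOf ↥(maximalRealSubfield F) (imagUnitSq F) F (2 * imagUnit F)⁻¹) (Chi ↥(maximalRealSubfield F) F (IsCMField.complexConj F)) ((uniformOmegaRep h F ι₁ V.conj Φ' e dV hdV hdV0 (iotaVConj h F ι₁ V Φ Φ' dV ιV hJc) (2 * imagUnit F)⁻¹ (repConj F (fun _ _ => r))).omega ν hν) ((uniformOmegaRep h F ι₁ V.conj Φ' e dV hdV hdV0 (iotaVConj h F ι₁ V Φ Φ' dV ιV hJc) (2 * imagUnit F)⁻¹ (repConj F (fun _ _ => r))).rho ν hν)).AdmIndex, i.1.1 ≠ ε → Θ (((AppendixC.toThm418Data (sec42DataOf h isoOf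 F ι₁ V Φ) ((muConj (uniformOmegaRep h F ι₁ V Φ e dV hdV hdV0 ιV (2 * imagUnit F)⁻¹ (fun _ _ => r))).rest tc)).transport (sec42DataOf h isoOf F ι₁ V.conj Φ').G (HermSpace3.adelicFinConj V).symm (Eps ↥(maximalRealSubfield F) (imagUnitSq F)) (epsOf ↥(maximalRealSubfield F) (imagUnitSq F) F (2 * imagUnit F)⁻¹) (Chi ↥(maximalRealSubfield F) F (IsCMField.complexConj F)) ((uniformOmegaRep h F ι₁ V.conj Φ' e dV hdV hdV0 (iotaVConj h F ι₁ V Φ Φ' dV ιV hJc) (2 * imagUnit F)⁻¹ (repConj F (fun _ _ => r))).omega ν hν) ((uniformOmegaRep h F ι₁ V.conj Φ' e dV hdV hdV0 (iotaVConj h F ι₁ V Φ Φ' dV ιV hJc) (2 * imagUnit F)⁻¹ (repConj F (fun _ _ => r))).rho ν hν)).galoisAct σ x) i = 0) := by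
  -- Part VI at every index `(ε′, χ′)`, read at `(ε, χ) := (locF (−1) · ε′, χ′⁻¹)` (verbatim ✔ `thm418AsPrinted_muConj_rest_transport_hermConj`)
  have key : ∀ (ε' : Eps ↥(maximalRealSubfield F) (imagUnitSq F)) (χ' : Chi ↥(maximalRealSubfield F) F (IsCMField.complexConj F)),
      ∃ Ω : (uniformOmegaRep h F ι₁ V Φ e dV hdV hdV0 ιV (2 * imagUnit F)⁻¹ (fun _ _ => r)).omega (galConj (IsCMField.complexConj F) ν) hν.galConj
          ((locF ↥(maximalRealSubfield F) (imagUnitSq F) (-1) * ε' : Eps ↥(maximalRealSubfield F) (imagUnitSq F))) (chiInv ↥(maximalRealSubfield F) F (IsCMField.complexConj F) χ') ≃ₗ[ℂ]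
          (uniformOmegaRep h F ι₁ V.conj Φ' e dV hdV hdV0 (iotaVConj h F ι₁ V Φ Φ' dV ιV hJc) (2 * imagUnit F)⁻¹ (repConj F (fun _ _ => r))).omega ν hν ε' χ',
        ∀ (g : (sec42DataOf h isoOf F ι₁ V Φ).G)
          (x : (uniformOmegaRep h F ι₁ V Φ e dV hdV hdV0 ιV (2 * imagUnit F)⁻¹ (fun _ _ => r)).omega (galConj (IsCMField.complexConj F) ν) hν.galConj
            ((locF ↥(maximalRealSubfield F) (imagUnitSq F) (-1) * ε' : Eps ↥(maximalRealSubfield F) (imagUnitSq F))) (chiInv ↥(maximalRealSubfield F) F (IsCMField.complexConj F) χ')),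
          Ω ((uniformOmegaRep h F ι₁ V Φ e dV hdV hdV0 ιV (2 * imagUnit F)⁻¹ (fun _ _ => r)).rho (galConj (IsCMField.complexConj F) ν) hν.galConj
              ((locF ↥(maximalRealSubfield F) (imagUnitSq F) (-1) * ε' : Eps ↥(maximalRealSubfield F) (imagUnitSq F))) (chiInv ↥(maximalRealSubfield F) F (IsCMField.complexConj F) χ') g x) =
            (uniformOmegaRep h F ι₁ V.conj Φ' e dV hdV hdV0 (iotaVConj h F ι₁ V Φ Φ' dV ιV hJc) (2 * imagUnit F)⁻¹ (repConj F (fun _ _ => r))).rho ν hν ε' χ' (phiConj h F ι₁ V Φ Φ' g) (Ω x) :=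
    fun ε' χ' => exists_uniformOmegaRep_conj_hermConj h F ι₁ V Φ Φ' e dV ιV (2 * imagUnit F)⁻¹ (fun _ _ => r) (repConj F (fun _ _ => r)) hdV hdV0 hJc ν hν
      ((locF ↥(maximalRealSubfield F) (imagUnitSq F) (-1) * ε' : Eps ↥(maximalRealSubfield F) (imagUnitSq F))) ε' rfl
      (chiInv ↥(maximalRealSubfield F) F (IsCMField.complexConj F) χ') χ'
      ((congrArg Subtype.val (chiInv_chiInv ↥(maximalRealSubfield F) F (IsCMField.complexConj F) χ')).symm.trans
        (chiInv_val ↥(maximalRealSubfield F) F (IsCMField.complexConj F) _))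
  choose Ω hΩ using key
  -- the equivariance clause along `φ := (adelicFinConj V)⁻¹`: `phiConj ((adelicFinConj V)⁻¹ g′) = g′`
  have hΩ' : ∀ (ε' : Eps ↥(maximalRealSubfield F) (imagUnitSq F)) (χ' : Chi ↥(maximalRealSubfield F) F (IsCMField.complexConj F))
      (g' : (sec42DataOf h isoOf F ι₁ V.conj Φ').G)
      (x : (uniformOmegaRep h F ι₁ V Φ e dV hdV hdV0 ιV (2 * imagUnit F)⁻¹ (fun _ _ => r)).omega (galConj (IsCMField.complexConj F) ν) hν.galConj
        ((locF ↥(maximalRealSubfield F) (imagUnitSq F) (-1) * ε' : Eps ↥(maximalRealSubfield F) (imagUnitSq F)))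
        (chiInv ↥(maximalRealSubfield F) F (IsCMField.complexConj F) χ')),
      Ω ε' χ' ((uniformOmegaRep h F ι₁ V Φ e dV hdV hdV0 ιV (2 * imagUnit F)⁻¹ (fun _ _ => r)).rho (galConj (IsCMField.complexConj F) ν) hν.galConj
          ((locF ↥(maximalRealSubfield F) (imagUnitSq F) (-1) * ε' : Eps ↥(maximalRealSubfield F) (imagUnitSq F)))
          (chiInv ↥(maximalRealSubfield F) F (IsCMField.complexConj F) χ') ((HermSpace3.adelicFinConj V).symm g') x) =
        (uniformOmegaRep h F ι₁ V.conj Φ' e dV hdV hdV0 (iotaVConj h F ι₁ V Φ Φ' dV ιV hJc) (2 * imagUnit F)⁻¹ (repConj F (fun _ _ => r))).rho ν hν ε' χ' g' (Ω ε' χ' x) := by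
    intro ε' χ' g' x
    have hg : phiConj h F ι₁ V Φ Φ' ((HermSpace3.adelicFinConj V).symm g') = g' :=
      ContinuousMulEquiv.apply_symm_apply (HermSpace3.adelicFinConj V) g'
    exact (hΩ ε' χ' ((HermSpace3.adelicFinConj V).symm g') x).trans
      (congrArg (fun y => (uniformOmegaRep h F ι₁ V.conj Φ' e dV hdV hdV0 (iotaVConj h F ι₁ V Φ Φ' dV ιV hJc) (2 * imagUnit F)⁻¹ (repConj F (fun _ _ => r))).rho ν hν ε' χ' y (Ω ε' χ' x)) hg)
  exact mainGalois_muConj_rest_transport (uniformOmegaRep h F ι₁ V Φ e dV hdV hdV0 ιV (2 * imagUnit F)⁻¹ (fun _ _ => r)) tc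
    (sec42DataOf h isoOf F ι₁ V.conj Φ').G (HermSpace3.adelicFinConj V).symm
    (Eps ↥(maximalRealSubfield F) (imagUnitSq F)) (epsOf ↥(maximalRealSubfield F) (imagUnitSq F) F (2 * imagUnit F)⁻¹)
    (Chi ↥(maximalRealSubfield F) F (IsCMField.complexConj F))
    ((uniformOmegaRep h F ι₁ V.conj Φ' e dV hdV hdV0 (iotaVConj h F ι₁ V Φ Φ' dV ιV hJc) (2 * imagUnit F)⁻¹ (repConj F (fun _ _ => r))).omega ν hν) ((uniformOmegaRep h F ι₁ V.conj Φ' e dV hdV hdV0 (iotaVConj h F ι₁ V Φ Φ' dV ιV hJc) (2 * imagUnit F)⁻¹ (repConj F (fun _ _ => r))).rho ν hν)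
    (epsNegEquiv F)
    (Function.Involutive.toPerm (chiInv ↥(maximalRealSubfield F) F (IsCMField.complexConj F))
      (chiInv_chiInv ↥(maximalRealSubfield F) F (IsCMField.complexConj F)))
    (fun x hx => epsOf_neg_of_complexConj_eq_neg F (2 * imagUnit F)⁻¹ (OmegaTransport.complexConj_inv_two_mul_imagUnit F)
      (OmegaTransport.inv_two_mul_imagUnit_ne_zero F) x hx.2.1 hx.1) Ω hΩ' hrow

end HermConj

end Summit.HodgeConjecture.CorCM.Lines.A3Liu418

end
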